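import Literature.Geometry.Riemannian.EigenvaluePinchingSphereMoserProofs
import Mathlib.Analysis.Matrix.Spectrum
import Literature.Geometry.Riemannian.GradientEstimateIntegration
import HarnessLib

/-!
# Eigenvalue pinching `λₙ ≤ n + ε ⇒ M ≅ Sⁿ` (Aubry 2005) — §3 bricks: Gram determinants, Lemme 13, Lemme 14, Lemme 15

Third proofs file of the named fact `aubry_diffeomorph_sphere_of_eigenvalue_pinching`
(`EigenvaluePinchingSphere.lean`; E. Aubry, Ann. Sci. ÉNS (4) 38 (2005) 387–405, Théorème 1),
after `EigenvaluePinchingSphereProofs.lean` (Parts A–B) and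
`EigenvaluePinchingSphereMoserProofs.lean` (Parts C–D: Lemme 11 (i), (ii) modulo the Sobolev
hypothesis `hSob`). In the degree computation of §3 (pp. 397–398) and in Lemme 18 (p. 401) the
printed proof passes from the almost-orthonormality of the sections `Sᵢ(x)` (Lemme 11 (ii)) and
their `L^∞` bound (Lemme 11 (i)) to estimates on the Gram determinant
`det(⟨Sᵢ(x), Sⱼ(x)⟩_E)` — "`‖h²‖_∞ ≤ (1 + C√ε)`", "`|h²(x) − 1| ≤ C ε^{1/4}` sur `M_ε`",
"`(Vol M)⁻¹ ∫ |h² − 1| ≤ C ε^{1/4}`" (p. 397–398, `h² = det(ᵗL_x L_x)`, `k = n + 1` sections), and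
"`|S_{n+1}(x)|² − 1 = det(⟨Sᵢ, Sⱼ⟩_E)ᵢⱼ − det Iₙ ≤ Cε^{1/4}`", "`|‖S_{n+1}‖₂² − 1| ≤ Cε^{1/4}`"
(p. 401, `k = n`). This file PROVES these steps, in the language of functions and modulo `hSob`,
with explicit constants, together with **Lemme 14** (p. 396) modulo its one external input, the
relative volume comparison "Vol B(x,η)/Vol M ≥ (η/Diam M)ⁿ" of Bishop–Gromov (hypothesis `hBG`;
the manifold layer of Bishop–Gromov is not yet in the tree), and **Lemme 13** (p. 396) modulo
`hSob` and `hBG`. No definitions and no named facts are introduced.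

## Contents (everything proved)

* Part E (linear algebra): `pow_le_det_and_det_le_pow` — for a real symmetric matrix with
  `a|v|² ≤ vᵀAv ≤ b|v|²` (`a ≥ 0`), `aᵏ ≤ det A ≤ bᵏ` (spectral theorem,
  `Matrix.IsHermitian.det_eq_prod_eigenvalues`); `dotProduct_mulVec_bounds_of_abs_sub_le` —
  entrywise `|Aᵢⱼ − δᵢⱼ| ≤ η` gives the quadratic bounds with `1 ∓ kη`;
  `abs_det_sub_one_le_of_abs_sub_le` — hence `|det A − 1| ≤ 2ᵏ kη` when `kη ≤ 1`.
* Part F (abstract Gram families on a closed manifold, continuing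
  `aubry_chebyshev_almostOrthonormal`): `gramDet_nonneg_and_le` (`0 ≤ det ≤ K^{2k}` from the
  `L^∞` bound), `aubry_gramDet_sub_one` (`|det − 1| ≤ 2ᵏkθ` on `M_η` and the `L¹` estimate
  `⨍|det − 1| ≤ 2ᵏkθ + (k(K²−1)/η) max(1, K^{2k} − 1)`, `θ = K² − 1 + η`; p. 398, first display).
* Part G (the pinched eigenfunctions): `aubry_normalizedGram` — the normalised family
  `⟨S̃ᵢ, S̃ⱼ⟩_E = cᵢcⱼ(g⁻¹(dfᵢ,dfⱼ) + fᵢfⱼ)`, `cᵢ = √(Vol/(μᵢ+1))`, satisfies the hypotheses of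
  Part F with `K = e^{a}`, `a = A√ε/(1 − ν^{−1/2})` (by `aubry_lemma11_i` and Part B);
  `aubry_gramDet_estimates` — the estimates of pp. 397–398 / 401 for it.
* Part H: `gradSq_sum_sq_eq` (`|d Σfᵢ²|² = 4|∇F_{f(x)}|²` with frozen coefficients),
  `aubry_sum_sq_estimates` — the three inputs "`‖h‖₁ = 1`, `‖h‖_∞ ≤ 1 + C√ε`, `‖dh‖_∞ ≤ C`" of
  Lemme 13 for `h = Σ fᵢ²` (p. 396), and `aubry_lemma15_core` — the bound on `Σ vᵢ ∇fᵢ(x)` for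
  `v ⊥ f(x)` behind Lemme 15 (p. 397); all modulo `hSob`.
* Part I: **Lemme 14** (`aubry_lemma14`): for a continuous `u` which is `L`-Lipschitz for the
  Riemannian distance on a closed manifold with distances `≤ D` satisfying the relative volume
  comparison `hBG`, `max u − u(x) ≤ 2 (Dᵐ Lᵐ (max u − ⨍u))^{1/(m+1)}` (the printed proof).
* Part J: `abs_sub_le_mul_toReal_riemEDist` (gradient bound ⇒ Lipschitz for `riemEDist`, from
  `ofReal_abs_sub_le_mul_riemEDist` of `GradientEstimateIntegration.lean`) and **Lemme 13**
  (`aubry_lemma13`): `|Σfᵢ(x)² − k/Vol| ≤ (C − k/Vol) + 2(Dᵐ(2C)ᵐ(C − k/Vol))^{1/(m+1)}`,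
  `C = e^{2a}(m+1+ε)/Vol`, modulo `hSob` and `hBG`.
* Part K: `aubry_diffeomorph_sphere_of_eigenvalue_pinching_of_prop12_prop19` — the named fact from
  Cheeger–Colding, Prop. 12 and Prop. 19 (the latter two in qualitative eigenfunction form, as
  hypotheses): the residual structure of the discharge.

What remains of §3 after this file: Bishop–Gromov on the manifold (hypothesis `hBG`; also the
bound `Vol M ≤ Vol Sⁿ` at the end of the proof of Prop. 12), the full Lemme 15 (the differential
of `Φ = f/|f| : M → Sⁿ` as a map of manifolds), the degree of `Φ` (orientation, degree theory and
the area formula `∫ det dΦ = deg Φ · Vol Sⁿ`), the Poincaré step for the signed `h = det L_x`, and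
the orientation cover.

## References

* E. Aubry, *Pincement sur le spectre et le volume en courbure de Ricci positive*, Ann. Sci.
  École Norm. Sup. (4) 38 (2005) 387–405: §3, Lemme 13, Lemme 14, Lemme 15 (pp. 396–397),
  pp. 397–398; §6, Lemme 18 and its proof (p. 401). [Aubry2005]
-/

noncomputable section

open Bundle Set Function Module Filter Manifold Finset
open _root_.MeasureTheory
open scoped Manifold ContDiff Topology BigOperators ENNReal

namespace Literature.Geometry.Riemannian

open Lorentzian Lorentzian.PseudoRiemannianMetric

/-! ## Part E — determinant bounds for almost-orthonormal Gram matrices -/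

section DetBounds

open Matrix

/-- **Determinant bounds from quadratic-form bounds.** For a real symmetric matrix `A` with
`a |v|² ≤ vᵀ A v ≤ b |v|²` for all `v` (`a ≥ 0`), `a^k ≤ det A ≤ b^k` (`k` the size): the
eigenvalues lie in `[a, b]` (spectral theorem, `Matrix.IsHermitian.det_eq_prod_eigenvalues`). This
is how `|det(⟨Sᵢ, Sⱼ⟩) − 1|` is controlled from the almost-orthonormality of Lemme 11 (ii) in
Aubry 2005, p. 397 ("`|h²(x) − 1| ≤ C ε^{1/4}` sur `M_ε`") and p. 401 (Lemme 18), and how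
`h² = det(ᵗL L) ≤ (1 + C√ε)^{n+1}` follows from Lemme 11 (i) (p. 397).
[cite: Aubry2005, §3 (p. 397) and §6, proof of Lemme 18 (p. 401)] -/
theorem pow_le_det_and_det_le_pow {n : Type*} [Fintype n] [DecidableEq n]
    {A : Matrix n n ℝ} (hA : A.IsSymm) {a b : ℝ} (ha : 0 ≤ a)
    (hlow : ∀ v : n → ℝ, a * (v ⬝ᵥ v) ≤ v ⬝ᵥ (A *ᵥ v))
    (hup : ∀ v : n → ℝ, v ⬝ᵥ (A *ᵥ v) ≤ b * (v ⬝ᵥ v)) :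
    a ^ Fintype.card n ≤ A.det ∧ A.det ≤ b ^ Fintype.card n := by
  have hH : A.IsHermitian := (isHermitian_iff_isSymm).2 hA
  have hev : ∀ i, a ≤ hH.eigenvalues i ∧ hH.eigenvalues i ≤ b := by
    intro i
    set v : n → ℝ := ⇑(hH.eigenvectorBasis i) with hv
    have hvv : v ⬝ᵥ v = 1 := by
      have h1 : ‖hH.eigenvectorBasis i‖ = 1 := hH.eigenvectorBasis.orthonormal.1 i
      have h2 := EuclideanSpace.real_norm_sq_eq (hH.eigenvectorBasis i)
      rw [h1, one_pow] at h2
      rw [h2, dotProduct]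
      refine Finset.sum_congr rfl fun j _ ↦ ?_
      rw [hv, sq]
    have hq : hH.eigenvalues i = v ⬝ᵥ (A *ᵥ v) := by
      rw [hH.eigenvalues_eq i]
      simp only [RCLike.re_to_real, star_trivial, hv]
    refine ⟨?_, ?_⟩
    · have := hlow v
      rwa [hvv, mul_one, ← hq] at this
    · have := hup v
      rwa [hvv, mul_one, ← hq] at this
  have hdet : A.det = ∏ i, hH.eigenvalues i := by
    have := hH.det_eq_prod_eigenvalues
    simpa using this
  rw [hdet]
  constructor
  · calc a ^ Fintype.card n = ∏ _i : n, a := by rw [Finset.prod_const, Finset.card_univ]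
      _ ≤ ∏ i, hH.eigenvalues i := Finset.prod_le_prod (fun i _ ↦ ha) (fun i _ ↦ (hev i).1)
  · calc ∏ i, hH.eigenvalues i ≤ ∏ _i : n, b :=
          Finset.prod_le_prod (fun i _ ↦ ha.trans (hev i).1) (fun i _ ↦ (hev i).2)
      _ = b ^ Fintype.card n := by rw [Finset.prod_const, Finset.card_univ]

/-- **Quadratic-form bounds from entrywise bounds**: if `|A i j − δᵢⱼ| ≤ η` for all `i, j` then
`(1 − kη)|v|² ≤ vᵀ A v ≤ (1 + kη)|v|²`, `k` the size (`|vᵀ(A − I)v| ≤ η (Σ|vᵢ|)² ≤ kη |v|²`).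
[folklore] -/
theorem dotProduct_mulVec_bounds_of_abs_sub_le {n : Type*} [Fintype n] [DecidableEq n]
    {A : Matrix n n ℝ} {η : ℝ} (hη0 : 0 ≤ η)
    (hη : ∀ i j, |A i j - (if i = j then 1 else 0)| ≤ η) (v : n → ℝ) :
    (1 - Fintype.card n * η) * (v ⬝ᵥ v) ≤ v ⬝ᵥ (A *ᵥ v) ∧
      v ⬝ᵥ (A *ᵥ v) ≤ (1 + Fintype.card n * η) * (v ⬝ᵥ v) := by
  -- `vᵀ A v = |v|² + Σᵢⱼ vᵢ (Aᵢⱼ - δᵢⱼ) vⱼ`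
  have hexp : v ⬝ᵥ (A *ᵥ v) =
      v ⬝ᵥ v + ∑ i, ∑ j, v i * (A i j - (if i = j then 1 else 0)) * v j := by
    have h1 : v ⬝ᵥ (A *ᵥ v) = ∑ i, ∑ j, v i * A i j * v j := by
      simp only [dotProduct, mulVec, Finset.mul_sum]
      refine Finset.sum_congr rfl fun i _ ↦ Finset.sum_congr rfl fun j _ ↦ ?_
      ring
    have h2 : v ⬝ᵥ v = ∑ i, ∑ j, v i * (if i = j then 1 else 0) * v j := by
      simp only [dotProduct, mul_ite, mul_one, mul_zero, ite_mul, zero_mul, Finset.sum_ite_eq,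
        Finset.mem_univ, if_true]
    rw [h1, h2, ← Finset.sum_add_distrib]
    refine Finset.sum_congr rfl fun i _ ↦ ?_
    rw [← Finset.sum_add_distrib]
    refine Finset.sum_congr rfl fun j _ ↦ ?_
    ring
  have hR : |∑ i, ∑ j, v i * (A i j - (if i = j then 1 else 0)) * v j| ≤
      Fintype.card n * η * (v ⬝ᵥ v) := by
    calc |∑ i, ∑ j, v i * (A i j - (if i = j then 1 else 0)) * v j|
        ≤ ∑ i, |∑ j, v i * (A i j - (if i = j then 1 else 0)) * v j| := abs_sum_le_sum_abs _ _
      _ ≤ ∑ i, ∑ j, |v i| * η * |v j| := by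
          refine Finset.sum_le_sum fun i _ ↦ (abs_sum_le_sum_abs _ _).trans
            (Finset.sum_le_sum fun j _ ↦ ?_)
          rw [abs_mul, abs_mul]
          gcongr
          exact hη i j
      _ = η * (∑ i, |v i|) ^ 2 := by
          rw [sq, Finset.sum_mul_sum, Finset.mul_sum]
          refine Finset.sum_congr rfl fun i _ ↦ ?_
          rw [Finset.mul_sum]
          refine Finset.sum_congr rfl fun j _ ↦ ?_
          ring
      _ ≤ η * (Fintype.card n * ∑ i, |v i| ^ 2) := by
          refine mul_le_mul_of_nonneg_left ?_ hη0
          have hcs := sq_sum_le_card_mul_sum_sq (s := (Finset.univ : Finset n)) (f := fun i ↦ |v i|)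
          rwa [Finset.card_univ] at hcs
      _ = Fintype.card n * η * (v ⬝ᵥ v) := by
          rw [dotProduct]
          simp only [sq_abs]
          simp only [sq]
          ring
  rw [hexp]
  obtain ⟨h1, h2⟩ := abs_le.1 hR
  constructor <;> linarith

/-- **Almost-orthonormal Gram matrices have determinant close to `1`**: for a real symmetric
`k × k` matrix with `|A i j − δᵢⱼ| ≤ η` and `kη ≤ 1`, `|det A − 1| ≤ 2^k · kη` — the step
"`|det(⟨Sᵢ,Sⱼ⟩_E)ᵢⱼ − det Iₙ| ≤ C(n)ε^{1/4}`" of Aubry 2005, p. 401 (and p. 397), with an explicit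
constant. [cite: Aubry2005, §6, proof of Lemme 18 (p. 401)] -/
theorem abs_det_sub_one_le_of_abs_sub_le {n : Type*} [Fintype n] [DecidableEq n]
    {A : Matrix n n ℝ} (hA : A.IsSymm) {η : ℝ} (hη0 : 0 ≤ η)
    (hη : ∀ i j, |A i j - (if i = j then 1 else 0)| ≤ η) (hsmall : Fintype.card n * η ≤ 1) :
    |A.det - 1| ≤ 2 ^ Fintype.card n * (Fintype.card n * η) := by
  set x := (Fintype.card n : ℝ) * η with hx
  set k := Fintype.card n with hk
  have hx0 : 0 ≤ x := mul_nonneg (Nat.cast_nonneg _) hη0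
  have hb := fun v ↦ dotProduct_mulVec_bounds_of_abs_sub_le hη0 hη v
  obtain ⟨hlow, hup⟩ := pow_le_det_and_det_le_pow hA (a := 1 - x) (b := 1 + x) (by linarith)
    (fun v ↦ (hb v).1) (fun v ↦ (hb v).2)
  have h2k : (k : ℝ) ≤ 2 ^ k := by exact_mod_cast (Nat.lt_two_pow_self).le
  -- `(1 + x)^k ≤ 1 + (2^k - 1) x` for `0 ≤ x ≤ 1`
  have hbin : ∀ j : ℕ, (1 + x) ^ j ≤ 1 + (2 ^ j - 1) * x := by
    intro j
    induction j with
    | zero => simp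
    | succ j ih =>
      have hx2 : x * x ≤ x := by nlinarith
      calc (1 + x) ^ (j + 1) = (1 + x) ^ j * (1 + x) := pow_succ _ _
        _ ≤ (1 + (2 ^ j - 1) * x) * (1 + x) :=
            mul_le_mul_of_nonneg_right ih (by linarith)
        _ = 1 + (2 ^ j - 1) * x + x + (2 ^ j - 1) * (x * x) := by ring
        _ ≤ 1 + (2 ^ j - 1) * x + x + (2 ^ j - 1) * x := by
            have h2j : (1 : ℝ) ≤ 2 ^ j := one_le_pow₀ (by norm_num)
            nlinarith
        _ = 1 + (2 ^ (j + 1) - 1) * x := by rw [pow_succ]; ring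
  have hupper : A.det - 1 ≤ 2 ^ k * x := by
    have := hbin k
    nlinarith
  have hlower : 1 - A.det ≤ 2 ^ k * x := by
    have hB := one_add_mul_le_pow (show (-2 : ℝ) ≤ -x by linarith) k
    -- `1 + k(-x) ≤ (1 - x)^k ≤ det A`
    have : (1 : ℝ) + k * (-x) ≤ A.det := by
      calc (1 : ℝ) + k * (-x) ≤ (1 + (-x)) ^ k := hB
        _ = (1 - x) ^ k := by ring
        _ ≤ A.det := hlow
    nlinarith
  rw [abs_le]
  constructor <;> linarith


end DetBounds

/-! ## Part F — Gram determinants of almost-orthonormal families (pp. 397–398, 401) -/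

section GramDeterminantAlgebra

open Matrix

variable {N : Type*}

/-- The quadratic form of the pointwise Gram matrix is the double sum `Σᵢⱼ vᵢvⱼ P i j x`. [folklore] -/
theorem dotProduct_gramMatrix_mulVec {k : ℕ} (P : Fin k → Fin k → N → ℝ) (x : N) (v : Fin k → ℝ) :
    v ⬝ᵥ (Matrix.of (fun i j ↦ P i j x) *ᵥ v) = ∑ i, ∑ j, v i * v j * P i j x := by
  simp only [dotProduct, mulVec, Matrix.of_apply, Finset.mul_sum]
  refine Finset.sum_congr rfl fun i _ ↦ Finset.sum_congr rfl fun j _ ↦ ?_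
  ring

/-- **`0 ≤ det(⟨S̃ᵢ(x), S̃ⱼ(x)⟩) ≤ K^{2k}` everywhere** (Aubry 2005, p. 397: "`‖h²‖_∞ ≤ (1 + C√ε)`
car `h²(x) ≤ |L_x|^{2n}` et d'après le lemme 11 (i) …"): for a symmetric pointwise Gram family
whose quadratic form satisfies `0 ≤ Σᵢⱼ αᵢαⱼ P i j (x) ≤ K² Σ αᵢ²`, the Gram determinant lies in
`[0, (K²)^k]` (eigenvalues in `[0, K²]`, `pow_le_det_and_det_le_pow`).
[cite: Aubry2005, §3 (p. 397)] -/
theorem gramDet_nonneg_and_le {k : ℕ} (P : Fin k → Fin k → N → ℝ)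
    (hPs : ∀ i j x, P i j x = P j i x) {K : ℝ}
    (hPpos : ∀ (α : Fin k → ℝ) (x : N), 0 ≤ ∑ i, ∑ j, α i * α j * P i j x)
    (hPsup : ∀ (α : Fin k → ℝ) (x : N), ∑ i, ∑ j, α i * α j * P i j x ≤ K ^ 2 * ∑ i, α i ^ 2)
    (x : N) :
    0 ≤ (Matrix.of fun i j ↦ P i j x).det ∧ (Matrix.of fun i j ↦ P i j x).det ≤ (K ^ 2) ^ k := by
  have hsymm : (Matrix.of fun i j ↦ P i j x).IsSymm := by
    ext i j
    simp only [Matrix.transpose_apply, Matrix.of_apply]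
    exact hPs j i x
  have hvv : ∀ v : Fin k → ℝ, v ⬝ᵥ v = ∑ i, v i ^ 2 := fun v ↦ by
    simp only [dotProduct, sq]
  obtain ⟨h1, h2⟩ := pow_le_det_and_det_le_pow hsymm (a := 0) (b := K ^ 2) le_rfl
    (fun v ↦ by rw [zero_mul, dotProduct_gramMatrix_mulVec]; exact hPpos v x)
    (fun v ↦ by rw [dotProduct_gramMatrix_mulVec, hvv]; exact hPsup v x)
  rw [Fintype.card_fin] at h1 h2
  refine ⟨?_, h2⟩
  rcases Nat.eq_zero_or_pos k with hk | hk
  · subst hk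
    simp [Matrix.det_fin_zero]
  · rwa [zero_pow hk.ne'] at h1

end GramDeterminantAlgebra

section GramDeterminant

open Matrix

variable {m : ℕ} {H : Type*} [TopologicalSpace H]
  {I : ModelWithCorners ℝ (EuclideanSpace ℝ (Fin m)) H} [I.Boundaryless]
  {N : Type*} [TopologicalSpace N] [ChartedSpace H N] [IsManifold I ∞ N] [CompactSpace N]
  [T2Space N] [MeasurableSpace N] [BorelSpace N]
  (h : ContMDiffRiemannianMetric I ∞ (EuclideanSpace ℝ (Fin m)) (TangentSpace I : N → Type _))

/-- **The Gram determinant is close to `1` on Aubry's set `M_η` and in `L¹`** (Aubry 2005, p. 397,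
last display, and p. 398, first display: "`|h²(x) − 1| ≤ C ε^{1/4}` sur `M_ε`" and
"`(Vol M)⁻¹ ∫ |h² − 1| ≤ (Vol M)⁻¹ ∫_{M_ε} |h² − 1| + (1 − Vol M_ε/Vol M) max(1, ‖h²‖_∞ − 1) ≤ Cε^{1/4}`";
the same computation with `k = n` is "`|‖S_{n+1}‖₂² − 1| ≤ C ε^{1/4}`" in the proof of Lemme 18,
p. 401). Abstract form, continuing `aubry_chebyshev_almostOrthonormal`: for a continuous symmetric
pointwise Gram family `P` with `⨍ P i i = 1`, `0 ≤ Σ αᵢαⱼ P i j ≤ K²|α|²` (`K ≥ 1`), `η > 0` and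
`θ := K² − 1 + η` with `kθ ≤ 1`: on the set `M_η` of that lemma `|det P(x) − 1| ≤ 2ᵏ kθ`, and

  `(Vol N)⁻¹ ∫ |det P − 1| dμ ≤ 2ᵏ kθ + (k(K² − 1)/η) · max(1, K^{2k} − 1)`.

[cite: Aubry2005, §3 (pp. 397–398); §6, proof of Lemme 18 (p. 401)] -/
theorem aubry_gramDet_sub_one [Nonempty N] {k : ℕ} (P : Fin k → Fin k → N → ℝ)
    (hPc : ∀ i j, Continuous (P i j)) (hPs : ∀ i j x, P i j x = P j i x)
    (hP1 : ∀ i, (riemannianMeasure h univ).toReal⁻¹ * ∫ x, P i i x ∂riemannianMeasure h = 1)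
    {K : ℝ} (hK : 1 ≤ K)
    (hPpos : ∀ (α : Fin k → ℝ) (x : N), 0 ≤ ∑ i, ∑ j, α i * α j * P i j x)
    (hPsup : ∀ (α : Fin k → ℝ) (x : N), ∑ i, ∑ j, α i * α j * P i j x ≤ K ^ 2 * ∑ i, α i ^ 2)
    {η : ℝ} (hη : 0 < η) (hsmall : k * (K ^ 2 - 1 + η) ≤ 1) :
    (∀ x ∈ {x : N | (∀ i j, i ≠ j → 2 * (1 - η) ≤ P i i x + P j j x - 2 * P i j x ∧
        2 * (1 - η) ≤ P i i x + P j j x + 2 * P i j x) ∧ ∀ i, 1 - η ≤ P i i x},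
        |(Matrix.of fun i j ↦ P i j x).det - 1| ≤ 2 ^ k * (k * (K ^ 2 - 1 + η))) ∧
      (riemannianMeasure h univ).toReal⁻¹ *
          ∫ x, |(Matrix.of fun i j ↦ P i j x).det - 1| ∂riemannianMeasure h ≤
        2 ^ k * (k * (K ^ 2 - 1 + η)) + k * (K ^ 2 - 1) / η * max 1 ((K ^ 2) ^ k - 1) := by
  haveI := isFiniteMeasure_riemannianMeasure h
  haveI := isOpenPosMeasure_riemannianMeasure h
  set V := (riemannianMeasure h univ).toReal with hVdef
  have hVpos : 0 < V := ENNReal.toReal_pos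
    (isOpen_univ.measure_pos (riemannianMeasure h) univ_nonempty).ne' (measure_ne_top _ _)
  set θ := K ^ 2 - 1 + η with hθ
  have hK2 : 1 ≤ K ^ 2 := by nlinarith
  have hθ0 : 0 ≤ θ := by rw [hθ]; linarith
  obtain ⟨hclosed, hvol, hon⟩ := aubry_chebyshev_almostOrthonormal h P hPc hPs hP1 hK hPsup hη
  set Mη : Set N := {x : N | (∀ i j, i ≠ j → 2 * (1 - η) ≤ P i i x + P j j x - 2 * P i j x ∧
        2 * (1 - η) ≤ P i i x + P j j x + 2 * P i j x) ∧ ∀ i, 1 - η ≤ P i i x} with hMη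
  set D : N → ℝ := fun x ↦ (Matrix.of fun i j ↦ P i j x).det with hD
  -- on `M_η`
  have honD : ∀ x ∈ Mη, |D x - 1| ≤ 2 ^ k * (k * θ) := by
    intro x hx
    have hsymm : (Matrix.of fun i j ↦ P i j x).IsSymm := by
      ext i j
      simp only [Matrix.transpose_apply, Matrix.of_apply]
      exact hPs j i x
    have h1 := abs_det_sub_one_le_of_abs_sub_le hsymm hθ0 (fun i j ↦ ?_)
      (by rwa [Fintype.card_fin])
    · rwa [Fintype.card_fin] at h1
    · rw [Matrix.of_apply]
      exact hon x hx i j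
  refine ⟨honD, ?_⟩
  -- everywhere: `|D - 1| ≤ max 1 (K^{2k} - 1)`
  have hDb : ∀ x, |D x - 1| ≤ max 1 ((K ^ 2) ^ k - 1) := by
    intro x
    obtain ⟨h0, h1⟩ := gramDet_nonneg_and_le P hPs hPpos hPsup x
    rw [abs_le]
    constructor
    · have := le_max_left (1 : ℝ) ((K ^ 2) ^ k - 1)
      simp only [hD]; linarith
    · have := le_max_right (1 : ℝ) ((K ^ 2) ^ k - 1)
      simp only [hD]; linarith
  -- continuity / integrability
  have hDc : Continuous D := by
    refine Continuous.matrix_det ?_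
    exact continuous_pi fun i ↦ continuous_pi fun j ↦ hPc i j
  have hmeas : MeasurableSet Mηᶜ := hclosed.measurableSet.compl
  -- pointwise: `|D - 1| ≤ 2^k kθ + max(1, K^{2k}-1) · 1_{M_ηᶜ}`
  have hpt : ∀ x, |D x - 1| ≤ 2 ^ k * (k * θ) +
      max 1 ((K ^ 2) ^ k - 1) * Mηᶜ.indicator (fun _ ↦ (1 : ℝ)) x := by
    intro x
    by_cases hx : x ∈ Mη
    · rw [indicator_of_notMem (by simpa using hx), mul_zero, add_zero]
      exact honD x hx
    · rw [indicator_of_mem (by simpa using hx), mul_one]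
      have h1 := hDb x
      have h2 : 0 ≤ 2 ^ k * (k * θ) := by positivity
      linarith
  have hI : ∫ x, |D x - 1| ∂riemannianMeasure h ≤
      2 ^ k * (k * θ) * V + max 1 ((K ^ 2) ^ k - 1) * (riemannianMeasure h Mηᶜ).toReal := by
    have hind : Integrable (fun x ↦ max 1 ((K ^ 2) ^ k - 1) * Mηᶜ.indicator (fun _ ↦ (1 : ℝ)) x)
        (riemannianMeasure h) := ((integrable_const (1 : ℝ)).indicator hmeas).const_mul _
    have hig : Integrable (fun x ↦ 2 ^ k * (k * θ) +
        max 1 ((K ^ 2) ^ k - 1) * Mηᶜ.indicator (fun _ ↦ (1 : ℝ)) x) (riemannianMeasure h) :=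
      (integrable_const _).add hind
    have h1 := integral_mono (integrable_of_continuous h (F := fun x ↦ |D x - 1|)
      ((hDc.sub continuous_const).abs)) hig hpt
    have h2 : ∫ x, (2 ^ k * (k * θ) + max 1 ((K ^ 2) ^ k - 1) * Mηᶜ.indicator (fun _ ↦ (1 : ℝ)) x)
        ∂riemannianMeasure h = 2 ^ k * (k * θ) * V +
          max 1 ((K ^ 2) ^ k - 1) * (riemannianMeasure h Mηᶜ).toReal := by
      rw [integral_add (integrable_const _) hind, integral_const, integral_const_mul,
        integral_indicator_const _ hmeas, smul_eq_mul, smul_eq_mul, measureReal_def,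
        measureReal_def, mul_one]
      ring
    linarith
  have hmax0 : 0 ≤ max 1 ((K ^ 2) ^ k - 1) := le_trans zero_le_one (le_max_left _ _)
  have h2 : max 1 ((K ^ 2) ^ k - 1) * (riemannianMeasure h Mηᶜ).toReal ≤
      max 1 ((K ^ 2) ^ k - 1) * (k * (K ^ 2 - 1) / η * V) := mul_le_mul_of_nonneg_left hvol hmax0
  calc V⁻¹ * ∫ x, |D x - 1| ∂riemannianMeasure h
      ≤ V⁻¹ * (2 ^ k * (k * θ) * V + max 1 ((K ^ 2) ^ k - 1) * (k * (K ^ 2 - 1) / η * V)) := by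
        refine mul_le_mul_of_nonneg_left (hI.trans ?_) (inv_nonneg.2 hVpos.le)
        linarith
    _ = 2 ^ k * (k * θ) + k * (K ^ 2 - 1) / η * max 1 ((K ^ 2) ^ k - 1) := by
        field_simp

end GramDeterminant

/-! ## Part G — the normalised Gram family of the pinched eigenfunctions -/

section NormalizedGram

open Matrix

variable {m : ℕ} {H : Type*} [TopologicalSpace H]
  {I : ModelWithCorners ℝ (EuclideanSpace ℝ (Fin m)) H} [I.Boundaryless]
  {N : Type*} [TopologicalSpace N] [ChartedSpace H N] [IsManifold I ∞ N] [CompactSpace N]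
  [T2Space N] [MeasurableSpace N] [BorelSpace N]
  (h : ContMDiffRiemannianMetric I ∞ (EuclideanSpace ℝ (Fin m)) (TangentSpace I : N → Type _))
  [(ofRiemannian h).HasLeviCivita] {k : ℕ} {f : Fin k → N → ℝ} {μ : Fin k → ℝ}

/-- **The normalised pointwise Gram family of the pinched eigenfunctions** (Aubry 2005, §2–§3):
`P i j (x) = ⟨S̃ᵢ(x), S̃ⱼ(x)⟩_E = cᵢcⱼ (g⁻¹(dfᵢ, dfⱼ)(x) + fᵢ(x)fⱼ(x))`, `cᵢ = √(Vol/(μᵢ+1))`, for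
smooth `L²(dμ_h)`-orthonormal `fᵢ` with `Δ_h fᵢ = −μᵢ fᵢ`, `m ≤ μᵢ ≤ m + ε`, on a closed nonempty
Riemannian `m`-manifold with `Ric ≥ m − 1` and the Sobolev inequality `hSob`. It is continuous and
symmetric, has normalised `L²`-norms `⨍ P i i = 1` (Part B), its quadratic form is
`Σ αᵢαⱼ P i j (x) = |S_{α'}(x)|² ≥ 0` (`α'ᵢ = αᵢcᵢ`, `gradSq_add_sq_linComb_eq_sum`) and, by
Lemme 11 (i) (`aubry_lemma11_i`), `≤ e^{2a} |α|²`, `a = A√ε/(1 − ν^{−1/2})`.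
[cite: Aubry2005, §2, Lemme 11 (pp. 393–394)] -/
theorem aubry_normalizedGram [Nonempty N]
    (hRic : ∀ (x : N) (v : TangentSpace I x),
      ((m : ℝ) - 1) * h.inner x v v ≤ (ofRiemannian h).ricci x v v)
    {ν A ε : ℝ} (hν : 1 < ν) (hA : 0 ≤ A) (hε : 0 ≤ ε)
    (hSob : ∀ v : N → ℝ, ContMDiff I 𝓘(ℝ, ℝ) ∞ v →
      ((riemannianMeasure h univ).toReal⁻¹ * ∫ x, |v x| ^ (2 * ν) ∂riemannianMeasure h)
          ^ (1 / (2 * ν)) ≤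
        A * Real.sqrt ((riemannianMeasure h univ).toReal⁻¹ *
              ∫ x, (ofRiemannian h).gradSq v x ∂riemannianMeasure h)
          + Real.sqrt ((riemannianMeasure h univ).toReal⁻¹ * ∫ x, v x ^ 2 ∂riemannianMeasure h))
    (hf : ∀ i, ContMDiff I 𝓘(ℝ, ℝ) ∞ (f i))
    (hΔ : ∀ (i : Fin k) (x : N), (ofRiemannian h).dalembertian (f i) x = -(μ i) * f i x)
    (hμ : ∀ i, (m : ℝ) ≤ μ i ∧ μ i ≤ m + ε)
    (horth : ∀ i j, ∫ x, f i x * f j x ∂riemannianMeasure h = if i = j then 1 else 0) :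
    let P : Fin k → Fin k → N → ℝ := fun i j x ↦
      Real.sqrt ((riemannianMeasure h univ).toReal / (μ i + 1)) *
        Real.sqrt ((riemannianMeasure h univ).toReal / (μ j + 1)) *
        ((ofRiemannian h).innerDual x (mvfderiv I (f i) x : TangentSpace I x →ₗ[ℝ] ℝ)
          (mvfderiv I (f j) x : TangentSpace I x →ₗ[ℝ] ℝ) + f i x * f j x)
    (∀ i j, Continuous (P i j)) ∧ (∀ i j x, P i j x = P j i x) ∧
      (∀ i, (riemannianMeasure h univ).toReal⁻¹ * ∫ x, P i i x ∂riemannianMeasure h = 1) ∧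
      (∀ (α : Fin k → ℝ) (x : N), 0 ≤ ∑ i, ∑ j, α i * α j * P i j x) ∧
      (∀ (α : Fin k → ℝ) (x : N), ∑ i, ∑ j, α i * α j * P i j x ≤
        Real.exp (A * Real.sqrt ε / (1 - (Real.sqrt ν)⁻¹)) ^ 2 * ∑ i, α i ^ 2) := by
  intro P
  haveI := isFiniteMeasure_riemannianMeasure h
  haveI := isOpenPosMeasure_riemannianMeasure h
  have hg : (ofRiemannian h).IsRiemannian := isRiemannian_ofRiemannian h
  set V := (riemannianMeasure h univ).toReal with hVdef
  have hVpos : 0 < V := ENNReal.toReal_pos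
    (isOpen_univ.measure_pos (riemannianMeasure h) univ_nonempty).ne' (measure_ne_top _ _)
  have hμ1 : ∀ i, 0 < μ i + 1 := fun i ↦ by linarith [(hμ i).1, (Nat.cast_nonneg m : (0 : ℝ) ≤ m)]
  set c : Fin k → ℝ := fun i ↦ Real.sqrt (V / (μ i + 1)) with hc
  have hc2 : ∀ i, c i ^ 2 = V / (μ i + 1) := fun i ↦ Real.sq_sqrt (div_nonneg hVpos.le (hμ1 i).le)
  set a := A * Real.sqrt ε / (1 - (Real.sqrt ν)⁻¹) with ha
  have hPdef : ∀ i j x, P i j x = c i * c j *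
      ((ofRiemannian h).innerDual x (mvfderiv I (f i) x : TangentSpace I x →ₗ[ℝ] ℝ)
        (mvfderiv I (f j) x : TangentSpace I x →ₗ[ℝ] ℝ) + f i x * f j x) := fun i j x ↦ rfl
  -- the quadratic form is `|S_{α'}|²`
  have hquad : ∀ (α : Fin k → ℝ) (x : N), ∑ i, ∑ j, α i * α j * P i j x =
      (ofRiemannian h).gradSq (fun y ↦ ∑ i, (α i * c i) * f i y) x +
        (∑ i, (α i * c i) * f i x) ^ 2 := by
    intro α x
    rw [gradSq_add_sq_linComb_eq_sum h hf (fun i ↦ α i * c i) x]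
    refine Finset.sum_congr rfl fun i _ ↦ Finset.sum_congr rfl fun j _ ↦ ?_
    rw [hPdef]
    ring
  refine ⟨?_, ?_, ?_, ?_, ?_⟩
  · intro i j
    exact continuous_const.mul ((contMDiff_innerDual _ (hf i) (hf j)).continuous.add
      ((hf i).continuous.mul (hf j).continuous))
  · intro i j x
    rw [hPdef, hPdef, (ofRiemannian h).innerDual_comm x, mul_comm (c i) (c j),
      mul_comm (f i x) (f j x)]
  · intro i
    have hI : ∫ x, ((ofRiemannian h).innerDual x (mvfderiv I (f i) x : TangentSpace I x →ₗ[ℝ] ℝ)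
        (mvfderiv I (f i) x : TangentSpace I x →ₗ[ℝ] ℝ) + f i x * f i x) ∂riemannianMeasure h =
        μ i + 1 := by
      have h1 := integral_gradSq_eq_of_dalembertian_eq h
        ((hf i).of_le (WithTop.coe_le_coe.mpr le_top)) (hΔ i)
      have h2 : ∫ x, f i x ^ 2 ∂riemannianMeasure h = 1 := by
        rw [← horth i i |>.trans (if_pos rfl)]
        exact integral_congr_ae (Eventually.of_forall fun x ↦ by simp [sq])
      rw [integral_add (integrable_of_continuous h (contMDiff_innerDual _ (hf i) (hf i)).continuous)
        (integrable_of_continuous h (F := fun x ↦ f i x * f i x)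
          ((hf i).continuous.mul (hf i).continuous))]
      have h3 : ∫ x, (ofRiemannian h).innerDual x (mvfderiv I (f i) x : TangentSpace I x →ₗ[ℝ] ℝ)
          (mvfderiv I (f i) x : TangentSpace I x →ₗ[ℝ] ℝ) ∂riemannianMeasure h = μ i * 1 := by
        rw [← h2]; exact h1
      have h4 : ∫ x, f i x * f i x ∂riemannianMeasure h = 1 := by rw [horth i i, if_pos rfl]
      rw [h3, h4, mul_one]
    have hfun : (fun x ↦ P i i x) = fun x ↦ c i * c i *
        ((ofRiemannian h).innerDual x (mvfderiv I (f i) x : TangentSpace I x →ₗ[ℝ] ℝ)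
          (mvfderiv I (f i) x : TangentSpace I x →ₗ[ℝ] ℝ) + f i x * f i x) := funext fun x ↦ hPdef i i x
    rw [hfun, integral_const_mul, hI, ← sq, hc2 i]
    field_simp [hVpos.ne', (hμ1 i).ne']
  · intro α x
    rw [hquad]
    refine add_nonneg ?_ (sq_nonneg _)
    rw [PseudoRiemannianMetric.gradSq, innerDual_eq_val_sharp_sharp]
    exact (ofRiemannian h).val_self_nonneg' x hg _
  · intro α x
    have h1 := aubry_lemma11_i h hRic hν hA hε hSob hf hΔ hμ horth (fun i ↦ α i * c i) x
    have hnorm : V⁻¹ * ∑ i, (α i * c i) ^ 2 * (μ i + 1) = ∑ i, α i ^ 2 := by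
      rw [Finset.mul_sum]
      refine Finset.sum_congr rfl fun i _ ↦ ?_
      rw [mul_pow, hc2 i]
      field_simp [hVpos.ne', (hμ1 i).ne']
    rw [hquad, ← Real.exp_nat_mul]
    rw [← ha, hnorm] at h1
    push_cast
    exact h1

/-- **Aubry 2005, p. 397 (last display) – p. 398 (first display) and p. 401, in function form
modulo `hSob`.** For the normalised pointwise Gram family `P i j = ⟨S̃ᵢ, S̃ⱼ⟩_E` of `k` pinched
eigenfunctions (as in `aubry_normalizedGram`; `k = n + 1` gives `h² = det(ᵗL L)` of §3, `k = n` gives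
`|S₁ ∧ ⋯ ∧ Sₙ|²` of Lemme 18) and `a = A√ε/(1 − ν^{−1/2})`:

* `0 ≤ det P(x) ≤ e^{2ka}` everywhere ("`‖h²‖_∞ ≤ (1 + C√ε)`", "`‖S_{n+1}‖_∞ ≤ Π‖Sᵢ‖_∞`");
* for `η > 0` with `k(e^{2a} − 1 + η) ≤ 1`:
  `⨍ |det P − 1| ≤ 2ᵏk(e^{2a} − 1 + η) + (k(e^{2a} − 1)/η) max(1, e^{2ka} − 1)`
  (with `η = ε^{1/4}` and `e^{2a} − 1 ≤ C√ε` this is `≤ C(n) ε^{1/4}`).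

[cite: Aubry2005, §3 (pp. 397–398); §6, proof of Lemme 18 (p. 401)] -/
theorem aubry_gramDet_estimates [Nonempty N]
    (hRic : ∀ (x : N) (v : TangentSpace I x),
      ((m : ℝ) - 1) * h.inner x v v ≤ (ofRiemannian h).ricci x v v)
    {ν A ε : ℝ} (hν : 1 < ν) (hA : 0 ≤ A) (hε : 0 ≤ ε)
    (hSob : ∀ v : N → ℝ, ContMDiff I 𝓘(ℝ, ℝ) ∞ v →
      ((riemannianMeasure h univ).toReal⁻¹ * ∫ x, |v x| ^ (2 * ν) ∂riemannianMeasure h)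
          ^ (1 / (2 * ν)) ≤
        A * Real.sqrt ((riemannianMeasure h univ).toReal⁻¹ *
              ∫ x, (ofRiemannian h).gradSq v x ∂riemannianMeasure h)
          + Real.sqrt ((riemannianMeasure h univ).toReal⁻¹ * ∫ x, v x ^ 2 ∂riemannianMeasure h))
    (hf : ∀ i, ContMDiff I 𝓘(ℝ, ℝ) ∞ (f i))
    (hΔ : ∀ (i : Fin k) (x : N), (ofRiemannian h).dalembertian (f i) x = -(μ i) * f i x)
    (hμ : ∀ i, (m : ℝ) ≤ μ i ∧ μ i ≤ m + ε)
    (horth : ∀ i j, ∫ x, f i x * f j x ∂riemannianMeasure h = if i = j then 1 else 0)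
    {η : ℝ} (hη : 0 < η)
    (hsmall : k * (Real.exp (A * Real.sqrt ε / (1 - (Real.sqrt ν)⁻¹)) ^ 2 - 1 + η) ≤ 1) :
    let P : Fin k → Fin k → N → ℝ := fun i j x ↦
      Real.sqrt ((riemannianMeasure h univ).toReal / (μ i + 1)) *
        Real.sqrt ((riemannianMeasure h univ).toReal / (μ j + 1)) *
        ((ofRiemannian h).innerDual x (mvfderiv I (f i) x : TangentSpace I x →ₗ[ℝ] ℝ)
          (mvfderiv I (f j) x : TangentSpace I x →ₗ[ℝ] ℝ) + f i x * f j x)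
    let K : ℝ := Real.exp (A * Real.sqrt ε / (1 - (Real.sqrt ν)⁻¹))
    (∀ x, 0 ≤ (Matrix.of fun i j ↦ P i j x).det ∧ (Matrix.of fun i j ↦ P i j x).det ≤ (K ^ 2) ^ k) ∧
      (riemannianMeasure h univ).toReal⁻¹ *
          ∫ x, |(Matrix.of fun i j ↦ P i j x).det - 1| ∂riemannianMeasure h ≤
        2 ^ k * (k * (K ^ 2 - 1 + η)) + k * (K ^ 2 - 1) / η * max 1 ((K ^ 2) ^ k - 1) := by
  intro P K
  obtain ⟨hPc, hPs, hP1, hPpos, hPsup⟩ :=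
    aubry_normalizedGram h hRic hν hA hε hSob hf hΔ hμ horth
  have hK : 1 ≤ K := by
    have ha0 : 0 ≤ A * Real.sqrt ε / (1 - (Real.sqrt ν)⁻¹) := by
      refine div_nonneg (mul_nonneg hA (Real.sqrt_nonneg ε)) ?_
      have hsν : 1 < Real.sqrt ν := by
        rw [show (1 : ℝ) = Real.sqrt 1 from Real.sqrt_one.symm]
        exact Real.sqrt_lt_sqrt zero_le_one hν
      have := inv_lt_one_of_one_lt₀ hsν
      linarith
    exact Real.one_le_exp ha0
  refine ⟨fun x ↦ gramDet_nonneg_and_le P hPs hPpos hPsup x, ?_⟩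
  exact (aubry_gramDet_sub_one h P hPc hPs hP1 hK hPpos hPsup hη hsmall).2

end NormalizedGram

/-! ## Part H — the inputs of Lemme 13 and the core of Lemme 15 (p. 396–397) -/

section SumOfSquares

variable {m : ℕ} {H : Type*} [TopologicalSpace H]
  {I : ModelWithCorners ℝ (EuclideanSpace ℝ (Fin m)) H} [I.Boundaryless]
  {N : Type*} [TopologicalSpace N] [ChartedSpace H N] [IsManifold I ∞ N] [CompactSpace N]
  [T2Space N] [MeasurableSpace N] [BorelSpace N]
  (h : ContMDiffRiemannianMetric I ∞ (EuclideanSpace ℝ (Fin m)) (TangentSpace I : N → Type _))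
  [(ofRiemannian h).HasLeviCivita] {k : ℕ} {f : Fin k → N → ℝ} {μ : Fin k → ℝ}

omit [CompactSpace N] [T2Space N] [MeasurableSpace N] [BorelSpace N] [I.Boundaryless]
  [(ofRiemannian h).HasLeviCivita] in
/-- **`d(Σ fᵢ²)_x = 2 d(Σ fᵢ(x) fᵢ)_x`**: the differential of `h = Σ fᵢ²` at `x` is twice that of the
linear combination with the FROZEN coefficients `αᵢ = fᵢ(x)` (so `|dh|²(x) = 4|∇F_α|²(x)`), the
step "en appliquant le lemme 11 avec `αᵢ = fᵢ(x₀)`" of Aubry 2005, proof of Lemme 13 (p. 396).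
[cite: Aubry2005, §3, proof of Lemme 13 (p. 396)] -/
theorem gradSq_sum_sq_eq (hf : ∀ i, ContMDiff I 𝓘(ℝ, ℝ) ∞ (f i)) (x : N) :
    (ofRiemannian h).gradSq (fun y ↦ ∑ i, f i y ^ 2) x =
      4 * (ofRiemannian h).gradSq (fun y ↦ ∑ i, f i x * f i y) x := by
  have hfd : ∀ i, MDifferentiableAt I 𝓘(ℝ, ℝ) (f i) x := fun i ↦ (hf i).mdifferentiableAt (by simp)
  have hsqd : ∀ i, MDifferentiableAt I 𝓘(ℝ, ℝ) (fun y ↦ f i y ^ 2) x := fun i ↦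
    ((differentiable_pow 2).differentiableAt).comp_mdifferentiableAt (hfd i)
  have hcfd : ∀ i, MDifferentiableAt I 𝓘(ℝ, ℝ) (fun y ↦ f i x * f i y) x := fun i ↦
    (mdifferentiableAt_const (c := f i x)).mul (hfd i)
  have hd1 := (mvfderiv_finset_sum (I := I) Finset.univ (F := fun i y ↦ f i y ^ 2) (p := x)
      (fun i _ ↦ hsqd i)).2
  have hd2 := (mvfderiv_finset_sum (I := I) Finset.univ (F := fun i y ↦ f i x * f i y) (p := x)
      (fun i _ ↦ hcfd i)).2
  have hd : (mvfderiv I (fun y ↦ ∑ i, f i y ^ 2) x : TangentSpace I x →ₗ[ℝ] ℝ) =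
      (2 : ℝ) • (mvfderiv I (fun y ↦ ∑ i, f i x * f i y) x : TangentSpace I x →ₗ[ℝ] ℝ) := by
    ext v
    rw [ContinuousLinearMap.coe_coe, hd1, LinearMap.smul_apply, ContinuousLinearMap.coe_coe, hd2,
      _root_.sum_apply, _root_.sum_apply, smul_eq_mul, Finset.mul_sum]
    refine Finset.sum_congr rfl fun i _ ↦ ?_
    have h1 := mvfderiv_real_comp (I := I) (ζ := fun t : ℝ ↦ t ^ 2)
      ((differentiable_pow 2).differentiableAt) (hfd i) v
    have hder : deriv (fun t : ℝ ↦ t ^ 2) (f i x) = 2 * f i x := by simp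
    rw [hder] at h1
    rw [show (fun y ↦ f i y ^ 2) = (fun t : ℝ ↦ t ^ 2) ∘ f i from rfl, h1,
      mvfderiv_fun_mul (mdifferentiableAt_const (c := f i x)) (hfd i)]
    simp [mvfderiv_const]
    ring
  rw [PseudoRiemannianMetric.gradSq, PseudoRiemannianMetric.gradSq, hd, innerDual_smul_left,
    innerDual_smul_right]
  ring

/-- **The inputs of Lemme 13** (Aubry 2005, p. 396: "la fonction `h = Σᵢ fᵢ²` vérifie les
inégalités `‖h‖₁ = 1`, `‖h‖_∞ ≤ (1 + C√ε)` et `‖dh‖_∞ ≤ C(n)`"), in the normalisation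
`∫ fᵢfⱼ = δᵢⱼ` of the named fact (Aubry's `√(n+1)fᵢ` are `L²`-orthonormal for the NORMALISED
measure, so his `h` is `(Vol/(n+1))` times ours) and modulo `hSob`: for the pinched eigenfunctions
of `aubry_lemma11_i`, `h = Σᵢ fᵢ²` has

  `⨍ h = k/Vol`,  `h(x) ≤ e^{2a}(m + 1 + ε)/Vol`,  `|dh|²(x) ≤ 4 e^{2a} ((m+1+ε)/Vol) h(x)`,

`a = A√ε/(1 − ν^{−1/2})`: Lemme 11 (i) with the frozen coefficients `αᵢ = fᵢ(x)` gives
`|Σ fᵢ(x)Sᵢ(x)|² ≤ e^{2a} Vol⁻¹ Σ fᵢ(x)²(μᵢ+1) ≤ e^{2a}((m+1+ε)/Vol) h(x)`, whose `e`-component is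
`h(x)²` and whose `TM`-component is `|dh|²(x)/4`. [cite: Aubry2005, §3, proof of Lemme 13 (p. 396)] -/
theorem aubry_sum_sq_estimates
    (hRic : ∀ (x : N) (v : TangentSpace I x),
      ((m : ℝ) - 1) * h.inner x v v ≤ (ofRiemannian h).ricci x v v)
    {ν A ε : ℝ} (hν : 1 < ν) (hA : 0 ≤ A) (hε : 0 ≤ ε)
    (hSob : ∀ v : N → ℝ, ContMDiff I 𝓘(ℝ, ℝ) ∞ v →
      ((riemannianMeasure h univ).toReal⁻¹ * ∫ x, |v x| ^ (2 * ν) ∂riemannianMeasure h)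
          ^ (1 / (2 * ν)) ≤
        A * Real.sqrt ((riemannianMeasure h univ).toReal⁻¹ *
              ∫ x, (ofRiemannian h).gradSq v x ∂riemannianMeasure h)
          + Real.sqrt ((riemannianMeasure h univ).toReal⁻¹ * ∫ x, v x ^ 2 ∂riemannianMeasure h))
    (hf : ∀ i, ContMDiff I 𝓘(ℝ, ℝ) ∞ (f i))
    (hΔ : ∀ (i : Fin k) (x : N), (ofRiemannian h).dalembertian (f i) x = -(μ i) * f i x)
    (hμ : ∀ i, (m : ℝ) ≤ μ i ∧ μ i ≤ m + ε)
    (horth : ∀ i j, ∫ x, f i x * f j x ∂riemannianMeasure h = if i = j then 1 else 0) :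
    (riemannianMeasure h univ).toReal⁻¹ * ∫ x, (∑ i, f i x ^ 2) ∂riemannianMeasure h =
        k / (riemannianMeasure h univ).toReal ∧
      (∀ x, ∑ i, f i x ^ 2 ≤ Real.exp (2 * (A * Real.sqrt ε / (1 - (Real.sqrt ν)⁻¹))) *
        ((m + 1 + ε) / (riemannianMeasure h univ).toReal)) ∧
      ∀ x, (ofRiemannian h).gradSq (fun y ↦ ∑ i, f i y ^ 2) x ≤
        4 * (Real.exp (2 * (A * Real.sqrt ε / (1 - (Real.sqrt ν)⁻¹))) *
          ((m + 1 + ε) / (riemannianMeasure h univ).toReal)) * ∑ i, f i x ^ 2 := by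
  have hg : (ofRiemannian h).IsRiemannian := isRiemannian_ofRiemannian h
  set V := (riemannianMeasure h univ).toReal with hVdef
  set K2 := Real.exp (2 * (A * Real.sqrt ε / (1 - (Real.sqrt ν)⁻¹))) with hK2
  have hV0 : 0 ≤ V⁻¹ := inv_nonneg.2 ENNReal.toReal_nonneg
  have hK20 : 0 ≤ K2 := (Real.exp_pos _).le
  -- Lemme 11 (i) with frozen coefficients
  have key : ∀ x, (ofRiemannian h).gradSq (fun y ↦ ∑ i, f i x * f i y) x + (∑ i, f i x * f i x) ^ 2 ≤
      K2 * ((m + 1 + ε) / V) * ∑ i, f i x ^ 2 := by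
    intro x
    have h1 := aubry_lemma11_i h hRic hν hA hε hSob hf hΔ hμ horth (fun i ↦ f i x) x
    refine h1.trans ?_
    rw [← hK2, mul_assoc]
    refine mul_le_mul_of_nonneg_left ?_ hK20
    calc V⁻¹ * ∑ i, f i x ^ 2 * (μ i + 1) ≤ V⁻¹ * ∑ i, f i x ^ 2 * (m + 1 + ε) :=
          mul_le_mul_of_nonneg_left (Finset.sum_le_sum fun i _ ↦ by
            have := (hμ i).2; nlinarith [sq_nonneg (f i x)]) hV0
      _ = (m + 1 + ε) / V * ∑ i, f i x ^ 2 := by rw [← Finset.sum_mul]; ring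
  have hsq : ∀ x, (∑ i, f i x * f i x) = ∑ i, f i x ^ 2 := fun x ↦
    Finset.sum_congr rfl fun i _ ↦ (sq (f i x)).symm
  refine ⟨?_, ?_, ?_⟩
  · -- the mean
    rw [integral_finsetSum _ (fun i _ ↦ integrable_of_continuous h (F := fun x ↦ f i x ^ 2)
      ((hf i).continuous.pow 2))]
    have h1 : ∀ i, ∫ x, f i x ^ 2 ∂riemannianMeasure h = 1 := fun i ↦ by
      rw [← (horth i i).trans (if_pos rfl)]
      exact integral_congr_ae (Eventually.of_forall fun x ↦ by simp [sq])
    simp only [h1, Finset.sum_const, Finset.card_univ, Fintype.card_fin, nsmul_eq_mul, mul_one]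
    rw [div_eq_inv_mul]
  · -- the sup bound: `h(x)² ≤ C h(x)`
    intro x
    have h1 := key x
    rw [hsq x] at h1
    have h0 : 0 ≤ (ofRiemannian h).gradSq (fun y ↦ ∑ i, f i x * f i y) x := by
      rw [PseudoRiemannianMetric.gradSq, innerDual_eq_val_sharp_sharp]
      exact (ofRiemannian h).val_self_nonneg' x hg _
    have hh0 : 0 ≤ ∑ i, f i x ^ 2 := Finset.sum_nonneg fun i _ ↦ sq_nonneg _
    by_cases hz : ∑ i, f i x ^ 2 = 0
    · rw [hz]; positivity
    · have hpos : 0 < ∑ i, f i x ^ 2 := lt_of_le_of_ne hh0 (Ne.symm hz)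
      nlinarith
  · -- the gradient bound
    intro x
    have h1 := key x
    rw [hsq x] at h1
    rw [gradSq_sum_sq_eq h hf x]
    nlinarith [sq_nonneg (∑ i, f i x ^ 2)]

/-- **The core of Lemme 15** ("`Φ` est presque contractante", Aubry 2005, p. 397: for
`v ∈ T_{Φ(x)}Sⁿ = Φ(x)^⊥`, `ᵗdΦ_x(v) = Σ vᵢSᵢ(x)/|f(x)|`, so `‖dΦ‖ ≤ ‖Σvᵢ Sᵢ‖_∞/|f|`), in the
language of functions and modulo `hSob`: for every `v ∈ ℝᵏ` orthogonal to `f(x) = (fᵢ(x))ᵢ`,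

  `|∇(Σ vᵢfᵢ)|²(x) ≤ e^{2a} ((m + 1 + ε)/Vol) |v|²`

(Lemme 11 (i) for `F_v = Σ vᵢfᵢ`, which vanishes at `x`). Dividing by `|f(x)|² = Σ fᵢ(x)²`
(controlled by Lemme 13) bounds the operator norm of `dΦ_x`. [cite: Aubry2005, §3, Lemme 15 (p. 397)] -/
theorem aubry_lemma15_core
    (hRic : ∀ (x : N) (v : TangentSpace I x),
      ((m : ℝ) - 1) * h.inner x v v ≤ (ofRiemannian h).ricci x v v)
    {ν A ε : ℝ} (hν : 1 < ν) (hA : 0 ≤ A) (hε : 0 ≤ ε)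
    (hSob : ∀ v : N → ℝ, ContMDiff I 𝓘(ℝ, ℝ) ∞ v →
      ((riemannianMeasure h univ).toReal⁻¹ * ∫ x, |v x| ^ (2 * ν) ∂riemannianMeasure h)
          ^ (1 / (2 * ν)) ≤
        A * Real.sqrt ((riemannianMeasure h univ).toReal⁻¹ *
              ∫ x, (ofRiemannian h).gradSq v x ∂riemannianMeasure h)
          + Real.sqrt ((riemannianMeasure h univ).toReal⁻¹ * ∫ x, v x ^ 2 ∂riemannianMeasure h))
    (hf : ∀ i, ContMDiff I 𝓘(ℝ, ℝ) ∞ (f i))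
    (hΔ : ∀ (i : Fin k) (x : N), (ofRiemannian h).dalembertian (f i) x = -(μ i) * f i x)
    (hμ : ∀ i, (m : ℝ) ≤ μ i ∧ μ i ≤ m + ε)
    (horth : ∀ i j, ∫ x, f i x * f j x ∂riemannianMeasure h = if i = j then 1 else 0)
    (v : Fin k → ℝ) (x : N) (hv : ∑ i, v i * f i x = 0) :
    (ofRiemannian h).gradSq (fun y ↦ ∑ i, v i * f i y) x ≤
      Real.exp (2 * (A * Real.sqrt ε / (1 - (Real.sqrt ν)⁻¹))) *
        ((m + 1 + ε) / (riemannianMeasure h univ).toReal) * ∑ i, v i ^ 2 := by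
  set V := (riemannianMeasure h univ).toReal with hVdef
  have hV0 : 0 ≤ V⁻¹ := inv_nonneg.2 ENNReal.toReal_nonneg
  have h1 := aubry_lemma11_i h hRic hν hA hε hSob hf hΔ hμ horth v x
  rw [hv, zero_pow two_ne_zero, add_zero] at h1
  refine h1.trans ?_
  rw [mul_assoc]
  refine mul_le_mul_of_nonneg_left ?_ (Real.exp_pos _).le
  calc V⁻¹ * ∑ i, v i ^ 2 * (μ i + 1) ≤ V⁻¹ * ∑ i, v i ^ 2 * (m + 1 + ε) :=
        mul_le_mul_of_nonneg_left (Finset.sum_le_sum fun i _ ↦ by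
          have := (hμ i).2; nlinarith [sq_nonneg (v i)]) hV0
    _ = (m + 1 + ε) / V * ∑ i, v i ^ 2 := by rw [← Finset.sum_mul]; ring

end SumOfSquares


section MeanToInf

variable {m : ℕ} {H : Type*} [TopologicalSpace H]
  {I : ModelWithCorners ℝ (EuclideanSpace ℝ (Fin m)) H} [I.Boundaryless]
  {N : Type*} [TopologicalSpace N] [ChartedSpace H N] [IsManifold I ∞ N] [CompactSpace N]
  [T2Space N] [MeasurableSpace N] [BorelSpace N]
  (h : ContMDiffRiemannianMetric I ∞ (EuclideanSpace ℝ (Fin m)) (TangentSpace I : N → Type _))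

/-- **Aubry 2005, Lemme 14** (p. 396), modulo the relative volume comparison. Printed: "Soient
`(Mⁿ, g)` compacte et vérifiant `Ric ≥ 0` et `h : M → ℝ` une fonction lipschitzienne ; alors, pour
tout point `x` de `M`, on a
`|h|(x) ≥ ‖h‖_∞ − 2 (Diam M)^{n/(n+1)} ‖dh‖_∞^{n/(n+1)} (‖h‖_∞ − ‖h‖₁)^{1/(n+1)}`"
(normalised `L¹`-norm). The printed proof uses `Ric ≥ 0` only through "Le théorème de
Bishop–Gromov donne alors" `Vol B(x, η)/Vol M ≥ (η/Diam M)ⁿ`, which is taken here as the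
HYPOTHESIS `hBG` (Bishop–Gromov on the manifold is not yet in the tree); the rest is the printed
argument: `‖h‖₁ ≤ (Vol B/Vol M)(h(x) + ‖dh‖_∞ η) + (1 − Vol B/Vol M)‖h‖_∞` with
`η = (‖h‖_∞ − h(x))/(2‖dh‖_∞)`. Function form: `u` continuous with `|u(x) − u(y)| ≤ L d(x, y)`,
`S = max u` (an upper bound that is attained), `D ≥ diam`, `A = (Vol N)⁻¹ ∫ u`; then for every `x`

  `S − u(x) ≤ 2 (Dᵐ Lᵐ (S − A))^{1/(m+1)}`.

[cite: Aubry2005, §3, Lemme 14 (p. 396)] -/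
theorem aubry_lemma14 {u : N → ℝ} (hu : Continuous u) {L D S : ℝ} (hL : 0 < L) (hD : 0 < D)
    (hdiam : ∀ x y, (ofRiemannian h).riemEDist x y ≤ ENNReal.ofReal D)
    (hLip : ∀ x y, |u x - u y| ≤ L * ((ofRiemannian h).riemEDist x y).toReal)
    (hS : ∀ y, u y ≤ S) (hSmax : ∃ y, u y = S)
    (hBG : ∀ (x : N) (r : ℝ), 0 < r → r ≤ D →
      ENNReal.ofReal ((r / D) ^ m) * riemannianMeasure h univ ≤
        riemannianMeasure h ((ofRiemannian h).ball x (ENNReal.ofReal r)))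
    (x : N) :
    S - u x ≤ 2 * (D ^ m * L ^ m *
      (S - (riemannianMeasure h univ).toReal⁻¹ * ∫ y, u y ∂riemannianMeasure h)) ^ (1 / (m + 1 : ℝ)) := by
  haveI := isFiniteMeasure_riemannianMeasure h
  haveI := isOpenPosMeasure_riemannianMeasure h
  have hg : (ofRiemannian h).IsRiemannian := isRiemannian_ofRiemannian h
  set V := (riemannianMeasure h univ).toReal with hVdef
  have hVpos : 0 < V := ENNReal.toReal_pos
    (isOpen_univ.measure_pos (riemannianMeasure h) ⟨x, mem_univ x⟩).ne' (measure_ne_top _ _)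
  set A := V⁻¹ * ∫ y, u y ∂riemannianMeasure h with hAdef
  -- the mean is at most the max
  have hiu : Integrable u (riemannianMeasure h) := integrable_of_continuous h hu
  have hAS : A ≤ S := by
    have h1 : ∫ y, u y ∂riemannianMeasure h ≤ ∫ _y, S ∂riemannianMeasure h :=
      integral_mono hiu (integrable_const S) hS
    rw [integral_const, smul_eq_mul, measureReal_def] at h1
    rw [hAdef, ← div_eq_inv_mul, div_le_iff₀ hVpos]
    linarith
  have hm0 : (0 : ℝ) < m + 1 := by positivity
  have hRHS0 : 0 ≤ 2 * (D ^ m * L ^ m * (S - A)) ^ (1 / (m + 1 : ℝ)) :=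
    mul_nonneg zero_le_two (Real.rpow_nonneg (mul_nonneg (by positivity) (by linarith)) _)
  -- trivial case `u x = S`
  rcases eq_or_lt_of_le (hS x) with hux | hux
  · rw [hux, sub_self]; exact hRHS0
  -- distances are finite, bounded by `D`
  have hdfin : ∀ y z, (ofRiemannian h).riemEDist y z ≠ ⊤ := fun y z ↦
    ne_top_of_le_ne_top ENNReal.ofReal_ne_top (hdiam y z)
  have hdD : ∀ y z, ((ofRiemannian h).riemEDist y z).toReal ≤ D := fun y z ↦ by
    have := ENNReal.toReal_mono ENNReal.ofReal_ne_top (hdiam y z)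
    rwa [ENNReal.toReal_ofReal hD.le] at this
  -- `S - u x ≤ L D`, so `η ≤ D`
  obtain ⟨ystar, hystar⟩ := hSmax
  have hgap : S - u x ≤ L * D := by
    have h1 := hLip ystar x
    rw [hystar] at h1
    have h2 := hdD ystar x
    calc S - u x ≤ |S - u x| := le_abs_self _
      _ ≤ L * ((ofRiemannian h).riemEDist ystar x).toReal := h1
      _ ≤ L * D := mul_le_mul_of_nonneg_left h2 hL.le
  set η := (S - u x) / (2 * L) with hηdef
  have hη0 : 0 < η := div_pos (by linarith) (by positivity)
  have hηD : η ≤ D := by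
    rw [hηdef, div_le_iff₀ (by positivity)]
    nlinarith
  -- the ball `B = B(x, η)`
  set B := (ofRiemannian h).ball x (ENNReal.ofReal η) with hBdef
  have hBo : IsOpen B := PseudoRiemannianMetric.isOpen_ball hg x _
  have hBm : MeasurableSet B := hBo.measurableSet
  set b := (riemannianMeasure h B).toReal with hbdef
  have hbV : b ≤ V := ENNReal.toReal_mono (measure_ne_top _ _) (measure_mono (subset_univ B))
  have hbc : (riemannianMeasure h Bᶜ).toReal = V - b := by
    rw [measure_compl hBm (measure_ne_top _ _), ENNReal.toReal_sub_of_le (measure_mono (subset_univ B))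
      (measure_ne_top _ _)]
  -- on `B`: `u ≤ u x + L η`; off `B`: `u ≤ S`
  have honB : ∀ y ∈ B, u y ≤ u x + L * η := by
    intro y hy
    rw [hBdef, PseudoRiemannianMetric.mem_ball] at hy
    have hd : ((ofRiemannian h).riemEDist x y).toReal < η :=
      ENNReal.toReal_lt_of_lt_ofReal hy
    have h1 := hLip y x
    rw [show (ofRiemannian h).riemEDist y x = (ofRiemannian h).riemEDist x y by
      rw [riemEDist_eq hg, riemEDist_eq hg, PseudoRiemannianMetric.edist_comm]] at h1
    have h2 : u y - u x ≤ L * η := by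
      calc u y - u x ≤ |u y - u x| := le_abs_self _
        _ ≤ L * ((ofRiemannian h).riemEDist x y).toReal := h1
        _ ≤ L * η := mul_le_mul_of_nonneg_left hd.le hL.le
    linarith
  -- integrate
  have hint : V * A ≤ b * (u x + L * η) + (V - b) * S := by
    have hsplit := integral_add_compl hBm hiu
    have h1 : ∫ y in B, u y ∂riemannianMeasure h ≤ ∫ _y in B, (u x + L * η) ∂riemannianMeasure h :=
      setIntegral_mono_on hiu.integrableOn (integrableOn_const) hBm honB
    have h2 : ∫ y in Bᶜ, u y ∂riemannianMeasure h ≤ ∫ _y in Bᶜ, S ∂riemannianMeasure h :=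
      setIntegral_mono_on hiu.integrableOn (integrableOn_const) hBm.compl (fun y _ ↦ hS y)
    rw [setIntegral_const, smul_eq_mul, measureReal_def] at h1 h2
    rw [hbc] at h2
    have hVA : V * A = ∫ y, u y ∂riemannianMeasure h := by
      rw [hAdef, ← mul_assoc, mul_inv_cancel₀ hVpos.ne', one_mul]
    rw [hVA, ← hsplit]
    linarith
  -- hence `b (S - u x)/2 ≤ V (S - A)`
  have hkey : b * ((S - u x) / 2) ≤ V * (S - A) := by
    have hLη : L * η = (S - u x) / 2 := by
      rw [hηdef]; field_simp
    rw [hLη] at hint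
    nlinarith
  -- the volume comparison at radius `η`
  have hb : (η / D) ^ m * V ≤ b := by
    have h1 := hBG x η hη0 hηD
    have h2 := ENNReal.toReal_mono (measure_ne_top _ _) h1
    rwa [ENNReal.toReal_mul, ENNReal.toReal_ofReal (by positivity)] at h2
  -- combine: `(η/D)^m (S - u x) ≤ 2 (S - A)`
  have hcomb : (η / D) ^ m * (S - u x) ≤ 2 * (S - A) := by
    have h1 : (η / D) ^ m * V * ((S - u x) / 2) ≤ b * ((S - u x) / 2) :=
      mul_le_mul_of_nonneg_right hb (by linarith)
    have h2 : (η / D) ^ m * V * ((S - u x) / 2) ≤ V * (S - A) := h1.trans hkey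
    have h3 : (η / D) ^ m * ((S - u x) / 2) ≤ S - A := by
      have : V * ((η / D) ^ m * ((S - u x) / 2)) ≤ V * (S - A) := by nlinarith
      exact le_of_mul_le_mul_left this hVpos
    linarith
  -- `(S - u x)^{m+1} ≤ 2^{m+1} L^m D^m (S - A)`
  have hpow : (S - u x) ^ (m + 1) ≤ 2 ^ (m + 1) * (D ^ m * L ^ m * (S - A)) := by
    have hηm : (η / D) ^ m = (S - u x) ^ m / (2 * L * D) ^ m := by
      rw [hηdef, ← div_pow]
      congr 1
      field_simp
    rw [hηm, div_mul_eq_mul_div, div_le_iff₀ (by positivity)] at hcomb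
    calc (S - u x) ^ (m + 1) = (S - u x) ^ m * (S - u x) := pow_succ _ _
      _ ≤ 2 * (S - A) * (2 * L * D) ^ m := hcomb
      _ = 2 ^ (m + 1) * (D ^ m * L ^ m * (S - A)) := by rw [mul_pow, mul_pow, pow_succ]; ring
  -- take `(m+1)`-th roots
  have hSu0 : 0 ≤ S - u x := by linarith
  have hX0 : 0 ≤ D ^ m * L ^ m * (S - A) := mul_nonneg (by positivity) (by linarith)
  have h1 : S - u x = ((S - u x) ^ (m + 1)) ^ (1 / (m + 1 : ℝ)) := by
    rw [one_div, show ((m : ℝ) + 1) = ((m + 1 : ℕ) : ℝ) by push_cast; ring,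
      Real.pow_rpow_inv_natCast hSu0 (Nat.succ_ne_zero m)]
  rw [h1]
  calc ((S - u x) ^ (m + 1)) ^ (1 / (m + 1 : ℝ))
      ≤ (2 ^ (m + 1) * (D ^ m * L ^ m * (S - A))) ^ (1 / (m + 1 : ℝ)) :=
        Real.rpow_le_rpow (pow_nonneg hSu0 _) hpow (by positivity)
    _ = 2 * (D ^ m * L ^ m * (S - A)) ^ (1 / (m + 1 : ℝ)) := by
        rw [Real.mul_rpow (by positivity) hX0]
        congr 1
        rw [one_div, show ((m : ℝ) + 1) = ((m + 1 : ℕ) : ℝ) by push_cast; ring,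
          Real.pow_rpow_inv_natCast zero_le_two (Nat.succ_ne_zero m)]

end MeanToInf

/-! ## Part J — Lemme 13 modulo `hSob` and the volume comparison -/

section Lemma13

variable {m : ℕ} {H : Type*} [TopologicalSpace H]
  {I : ModelWithCorners ℝ (EuclideanSpace ℝ (Fin m)) H} [I.Boundaryless]
  {N : Type*} [TopologicalSpace N] [ChartedSpace H N] [IsManifold I ∞ N] [CompactSpace N]
  [T2Space N] [MeasurableSpace N] [BorelSpace N]
  (h : ContMDiffRiemannianMetric I ∞ (EuclideanSpace ℝ (Fin m)) (TangentSpace I : N → Type _))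
  [(ofRiemannian h).HasLeviCivita] {k : ℕ} {f : Fin k → N → ℝ} {μ : Fin k → ℝ}

omit [CompactSpace N] [MeasurableSpace N] [BorelSpace N] [(ofRiemannian h).HasLeviCivita]
  [I.Boundaryless] [T2Space N] in
/-- **From a gradient bound to a Lipschitz bound for the Riemannian distance** on a manifold of
finite diameter: if `u ∈ C¹` has `|∇u|² ≤ L²` everywhere (`L ≥ 0`) and all Riemannian distances
are finite, then `|u(x) − u(y)| ≤ L d(x, y)` (`ofReal_abs_sub_le_mul_riemEDist` of
`GradientEstimateIntegration.lean` with Cauchy–Schwarz `|du(v)| ≤ |∇u| |v|`). [folklore] -/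
theorem abs_sub_le_mul_toReal_riemEDist {u : N → ℝ} (hu : ContMDiff I 𝓘(ℝ, ℝ) 1 u) {L : ℝ}
    (hL : 0 ≤ L) (hgrad : ∀ x, (ofRiemannian h).gradSq u x ≤ L ^ 2)
    (hfin : ∀ x y, (ofRiemannian h).riemEDist x y ≠ ⊤) (x y : N) :
    |u x - u y| ≤ L * ((ofRiemannian h).riemEDist x y).toReal := by
  have hg : (ofRiemannian h).IsRiemannian := isRiemannian_ofRiemannian h
  have hLd : ∀ z ∈ (univ : Set N), ∀ v : TangentSpace I z,
      |mvfderiv I u z v| ≤ (⟨L, hL⟩ : NNReal) * Real.sqrt ((ofRiemannian h).val z v v) := by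
    intro z _ v
    have h1 := abs_mvfderiv_le_sqrt_gradSq_mul_sqrt (ofRiemannian h) hg u z v
    refine h1.trans (mul_le_mul_of_nonneg_right ?_ (Real.sqrt_nonneg _))
    calc Real.sqrt ((ofRiemannian h).gradSq u z) ≤ Real.sqrt (L ^ 2) := Real.sqrt_le_sqrt (hgrad z)
      _ = L := Real.sqrt_sq hL
  have hball : y ∈ (ofRiemannian h).ball x ⊤ := by
    rw [PseudoRiemannianMetric.mem_ball]
    exact (hfin x y).lt_top
  have h1 := ofReal_abs_sub_le_mul_riemEDist (ofRiemannian h) hg isOpen_univ hu.contMDiffOn hLd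
    (x := x) (ρ := ⊤) (subset_univ _) hball
  have h2 := ENNReal.toReal_mono (ENNReal.mul_ne_top ENNReal.coe_ne_top (hfin x y)) h1
  rwa [ENNReal.toReal_ofReal (abs_nonneg _), ENNReal.toReal_mul, ENNReal.coe_toReal] at h2

/-- **Aubry 2005, Lemme 13** (p. 396: "si `λ_{n+1} ≤ n + ε`, on a
`‖Σᵢ fᵢ² − 1‖_∞ ≤ C(n) ε^{1/(2(n+1))}`"), in function form, modulo the Sobolev inequality `hSob`
(Ilias [14]) and the relative volume comparison `hBG` (Bishop–Gromov on the manifold, the input of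
Lemme 14), with explicit constants and in the normalisation `∫ fᵢfⱼ = δᵢⱼ` of the named fact
(Aubry's `√(n+1) fᵢ` are `L²`-orthonormal for the normalised measure, so his `Σfᵢ² ≈ 1` reads
`Σfᵢ² ≈ k/Vol` here). For the pinched eigenfunctions `f₁, …, f_k` of `aubry_lemma11_i` on a closed
Riemannian `m`-manifold with `Ric ≥ m − 1` and all distances `≤ D`, put
`C = e^{2a}(m + 1 + ε)/Vol`, `a = A√ε/(1 − ν^{−1/2})`. Then for every `x`

  `|Σᵢ fᵢ(x)² − k/Vol| ≤ (C − k/Vol) + 2 (Dᵐ (2C)ᵐ (C − k/Vol))^{1/(m+1)}`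

(for `k = m + 1`, `C − k/Vol = ((m+1)(e^{2a} − 1) + εe^{2a})/Vol = O(√ε)/Vol`, giving Aubry's rate
`ε^{1/(2(n+1))}`). Proof as printed: `h = Σ fᵢ²` has `⨍h = k/Vol`, `h ≤ C`, `|∇h|² ≤ 4Ch ≤ (2C)²`
(`aubry_sum_sq_estimates`, i.e. Lemme 11 (i) with `αᵢ = fᵢ(x₀)`), hence is `2C`-Lipschitz, and
Lemme 14 (`aubry_lemma14`) bounds `max h − h(x)`. [cite: Aubry2005, §3, Lemme 13 and its proof (p. 396)] -/
theorem aubry_lemma13 [Nonempty N]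
    (hRic : ∀ (x : N) (v : TangentSpace I x),
      ((m : ℝ) - 1) * h.inner x v v ≤ (ofRiemannian h).ricci x v v)
    {ν A ε : ℝ} (hν : 1 < ν) (hA : 0 ≤ A) (hε : 0 ≤ ε)
    (hSob : ∀ v : N → ℝ, ContMDiff I 𝓘(ℝ, ℝ) ∞ v →
      ((riemannianMeasure h univ).toReal⁻¹ * ∫ x, |v x| ^ (2 * ν) ∂riemannianMeasure h)
          ^ (1 / (2 * ν)) ≤
        A * Real.sqrt ((riemannianMeasure h univ).toReal⁻¹ *
              ∫ x, (ofRiemannian h).gradSq v x ∂riemannianMeasure h)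
          + Real.sqrt ((riemannianMeasure h univ).toReal⁻¹ * ∫ x, v x ^ 2 ∂riemannianMeasure h))
    (hf : ∀ i, ContMDiff I 𝓘(ℝ, ℝ) ∞ (f i))
    (hΔ : ∀ (i : Fin k) (x : N), (ofRiemannian h).dalembertian (f i) x = -(μ i) * f i x)
    (hμ : ∀ i, (m : ℝ) ≤ μ i ∧ μ i ≤ m + ε)
    (horth : ∀ i j, ∫ x, f i x * f j x ∂riemannianMeasure h = if i = j then 1 else 0)
    {D : ℝ} (hD : 0 < D) (hdiam : ∀ x y, (ofRiemannian h).riemEDist x y ≤ ENNReal.ofReal D)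
    (hBG : ∀ (x : N) (r : ℝ), 0 < r → r ≤ D →
      ENNReal.ofReal ((r / D) ^ m) * riemannianMeasure h univ ≤
        riemannianMeasure h ((ofRiemannian h).ball x (ENNReal.ofReal r)))
    (x : N) :
    |∑ i, f i x ^ 2 - k / (riemannianMeasure h univ).toReal| ≤
      (Real.exp (2 * (A * Real.sqrt ε / (1 - (Real.sqrt ν)⁻¹))) *
          ((m + 1 + ε) / (riemannianMeasure h univ).toReal) - k / (riemannianMeasure h univ).toReal)
      + 2 * (D ^ m * (2 * (Real.exp (2 * (A * Real.sqrt ε / (1 - (Real.sqrt ν)⁻¹))) *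
          ((m + 1 + ε) / (riemannianMeasure h univ).toReal))) ^ m *
        (Real.exp (2 * (A * Real.sqrt ε / (1 - (Real.sqrt ν)⁻¹))) *
          ((m + 1 + ε) / (riemannianMeasure h univ).toReal) - k / (riemannianMeasure h univ).toReal))
        ^ (1 / (m + 1 : ℝ)) := by
  haveI := isFiniteMeasure_riemannianMeasure h
  haveI := isOpenPosMeasure_riemannianMeasure h
  set V := (riemannianMeasure h univ).toReal with hVdef
  set C := Real.exp (2 * (A * Real.sqrt ε / (1 - (Real.sqrt ν)⁻¹))) * ((m + 1 + ε) / V) with hCdef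
  have hVpos : 0 < V := ENNReal.toReal_pos
    (isOpen_univ.measure_pos (riemannianMeasure h) univ_nonempty).ne' (measure_ne_top _ _)
  obtain ⟨hmean, hsup, hgrad⟩ := aubry_sum_sq_estimates h hRic hν hA hε hSob hf hΔ hμ horth
  set u : N → ℝ := fun y ↦ ∑ i, f i y ^ 2 with hudef
  have huc : ContMDiff I 𝓘(ℝ, ℝ) ∞ u := by
    intro y
    exact contMDiffAt_finsetSum fun i _ ↦ ((contDiff_id.pow 2).comp_contMDiff (hf i)) y
  have hC0 : 0 < C := by
    rw [hCdef]
    refine mul_pos (Real.exp_pos _) (div_pos ?_ hVpos)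
    have := (Nat.cast_nonneg m : (0 : ℝ) ≤ m)
    linarith
  -- the maximum `S` of `u`
  obtain ⟨xmax, -, hxmax⟩ := isCompact_univ.exists_isMaxOn univ_nonempty huc.continuous.continuousOn
  set S := u xmax with hSdef
  have hS : ∀ y, u y ≤ S := fun y ↦ hxmax (mem_univ y)
  have hSC : S ≤ C := hsup xmax
  have hS0 : 0 ≤ S := le_trans (Finset.sum_nonneg fun i _ ↦ sq_nonneg (f i x)) (hS x)
  -- `u` is `2C`-Lipschitz
  have hgradC : ∀ y, (ofRiemannian h).gradSq u y ≤ (2 * C) ^ 2 := by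
    intro y
    have h1 := hgrad y
    have h2 : u y ≤ C := hsup y
    have h3 : 0 ≤ u y := Finset.sum_nonneg fun i _ ↦ sq_nonneg (f i y)
    calc (ofRiemannian h).gradSq u y ≤ 4 * C * u y := h1
      _ ≤ 4 * C * C := mul_le_mul_of_nonneg_left h2 (by positivity)
      _ = (2 * C) ^ 2 := by ring
  have hfin : ∀ y z, (ofRiemannian h).riemEDist y z ≠ ⊤ := fun y z ↦
    ne_top_of_le_ne_top ENNReal.ofReal_ne_top (hdiam y z)
  have hLip := abs_sub_le_mul_toReal_riemEDist h (huc.of_le (by exact_mod_cast le_top))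
    (by positivity : (0 : ℝ) ≤ 2 * C) hgradC hfin
  -- Lemme 14
  have h14 := aubry_lemma14 h huc.continuous (by positivity : (0 : ℝ) < 2 * C) hD hdiam hLip hS
    ⟨xmax, rfl⟩ hBG x
  rw [hmean] at h14
  -- assemble the two-sided bound
  have hA_le : (k : ℝ) / V ≤ S := by
    -- the mean is at most the max
    have h1 : ∫ y, u y ∂riemannianMeasure h ≤ ∫ _y, S ∂riemannianMeasure h :=
      integral_mono (integrable_of_continuous h huc.continuous) (integrable_const S) hS
    rw [integral_const, smul_eq_mul, measureReal_def] at h1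
    have h2 : V⁻¹ * ∫ y, u y ∂riemannianMeasure h = k / V := hmean
    rw [← h2, ← div_eq_inv_mul, div_le_iff₀ hVpos]
    linarith
  have hmono : (D ^ m * (2 * C) ^ m * (S - k / V)) ^ (1 / (m + 1 : ℝ)) ≤
      (D ^ m * (2 * C) ^ m * (C - k / V)) ^ (1 / (m + 1 : ℝ)) :=
    Real.rpow_le_rpow (mul_nonneg (by positivity) (by linarith))
      (mul_le_mul_of_nonneg_left (by linarith) (by positivity)) (by positivity)
  rw [abs_le]
  constructor
  · -- lower bound: `k/V - u x ≤ (S - u x) ≤ 2(...)`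
    have : (0 : ℝ) ≤ C - k / V := by linarith
    nlinarith [h14, hmono]
  · have h1 : u x ≤ C := hsup x
    have h2 : 0 ≤ 2 * (D ^ m * (2 * C) ^ m * (C - k / V)) ^ (1 / (m + 1 : ℝ)) :=
      mul_nonneg zero_le_two (Real.rpow_nonneg (mul_nonneg (by positivity) (by linarith)) _)
    show u x - k / V ≤ _
    linarith

end Lemma13

/-! ## Part K — the residual structure: Théorème 1 from Cheeger–Colding, Prop. 12 and Prop. 19 -/

section Assembly

/-- **Théorème 1 from its three printed inputs, in the vocabulary of the named fact** (Aubry 2005,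
p. 402: "la proposition suivante [Prop. 19] … combinée à la proposition 12 et au théorème de
J. Cheeger et T. Colding … démontre le théorème 1"), refining
`aubry_diffeomorph_sphere_of_eigenvalue_pinching_of_volume_pinching` (Part A): the named fact
follows from

* `hCC` : Cheeger–Colding's volume sphere theorem (`CheegerColding1997_thmA110`, undischarged);
* `h12` : **Proposition 12** (p. 395) in qualitative eigenfunction form — for every `n ≥ 2` and
  `δ > 0` there is `ε > 0` such that a closed connected Riemannian `n`-manifold with `Ric ≥ n − 1`
  carrying `n + 1` `L²(dv_g)`-orthonormal eigenfunctions `tr_g Hess fᵢ = −μᵢ fᵢ`, `0 < μᵢ ≤ n + ε`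
  (i.e. `λₙ₊₁ ≤ n + ε`), has `Vol M ≥ (1 − δ) Vol Sⁿ`;
* `h19` : **Proposition 19** (p. 402) in qualitative eigenfunction form — for every `n ≥ 2` and
  `ε' > 0` there is `ε > 0` such that `n` such eigenfunctions with `0 < μᵢ ≤ n + ε` force the
  existence of `n + 1` `L²`-orthonormal eigenfunctions with `0 < μ'ᵢ ≤ n + ε'`
  (i.e. `λₙ ≤ n + ε ⇒ λₙ₊₁ ≤ n + ε'`).

Neither `h12` nor `h19` is vendored as a named fact (D-0026); they are the two remaining
problem-specific inputs, whose printed proofs need, beyond the bricks proved in this unit's files: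
Bishop–Gromov on the manifold, the degree of the eigenmap and the area formula, the orientation
cover (Prop. 12); the `L²`-theory of Ruh's bundle `E = TM ⊕ ℝe` with Lemme 9 and Lemme 18, the
min–max principle for `Δ`, and Lemmes 16–17 (Prop. 19).
[cite: Aubry2005, Théorème 1 (p. 388) via Prop. 12 (p. 395), Prop. 19 (p. 402)] -/
theorem aubry_diffeomorph_sphere_of_eigenvalue_pinching_of_prop12_prop19
    (hCC : CheegerColding1997_thmA110)
    (h12 : ∀ (n : ℕ), 2 ≤ n → ∀ δ : ℝ, 0 < δ → ∃ ε : ℝ, 0 < ε ∧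
      ∀ (M : Type) [TopologicalSpace M] [T2Space M] [SecondCountableTopology M]
        [ChartedSpace (EuclideanSpace ℝ (Fin n)) M] [IsManifold (𝓡 n) ∞ M] [CompactSpace M]
        [ConnectedSpace M] [T3Space M] [MeasurableSpace M] [BorelSpace M]
        (g : Bundle.ContMDiffRiemannianMetric (𝓡 n) ∞ (EuclideanSpace ℝ (Fin n))
          (TangentSpace (𝓡 n) : M → Type _))
        (_ : (ofRiemannian g).HasLeviCivita) (f : Fin (n + 1) → M → ℝ) (μ : Fin (n + 1) → ℝ),
        (∀ (x : M) (v : TangentSpace (𝓡 n) x),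
            ((n : ℝ) - 1) * g.inner x v v ≤ (ofRiemannian g).ricci x v v) →
        (∀ i, ContMDiff (𝓡 n) 𝓘(ℝ, ℝ) ∞ (f i)) →
        (∀ (i : Fin (n + 1)) (x : M), (ofRiemannian g).dalembertian (f i) x = -(μ i) * f i x) →
        (∀ i, 0 < μ i ∧ μ i ≤ n + ε) →
        (∀ i j, ∫ x, f i x * f j x ∂(riemannianMeasure g) = if i = j then 1 else 0) →
        ENNReal.ofReal ((1 - δ) * unitSphereVolume n) ≤ riemannianMeasure g Set.univ)
    (h19 : ∀ (n : ℕ), 2 ≤ n → ∀ ε' : ℝ, 0 < ε' → ∃ ε : ℝ, 0 < ε ∧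
      ∀ (M : Type) [TopologicalSpace M] [T2Space M] [SecondCountableTopology M]
        [ChartedSpace (EuclideanSpace ℝ (Fin n)) M] [IsManifold (𝓡 n) ∞ M] [CompactSpace M]
        [ConnectedSpace M] [T3Space M] [MeasurableSpace M] [BorelSpace M]
        (g : Bundle.ContMDiffRiemannianMetric (𝓡 n) ∞ (EuclideanSpace ℝ (Fin n))
          (TangentSpace (𝓡 n) : M → Type _))
        (_ : (ofRiemannian g).HasLeviCivita) (f : Fin n → M → ℝ) (μ : Fin n → ℝ),
        (∀ (x : M) (v : TangentSpace (𝓡 n) x),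
            ((n : ℝ) - 1) * g.inner x v v ≤ (ofRiemannian g).ricci x v v) →
        (∀ i, ContMDiff (𝓡 n) 𝓘(ℝ, ℝ) ∞ (f i)) →
        (∀ (i : Fin n) (x : M), (ofRiemannian g).dalembertian (f i) x = -(μ i) * f i x) →
        (∀ i, 0 < μ i ∧ μ i ≤ n + ε) →
        (∀ i j, ∫ x, f i x * f j x ∂(riemannianMeasure g) = if i = j then 1 else 0) →
        ∃ (f' : Fin (n + 1) → M → ℝ) (μ' : Fin (n + 1) → ℝ),
          (∀ i, ContMDiff (𝓡 n) 𝓘(ℝ, ℝ) ∞ (f' i)) ∧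
          (∀ (i : Fin (n + 1)) (x : M), (ofRiemannian g).dalembertian (f' i) x = -(μ' i) * f' i x) ∧
          (∀ i, 0 < μ' i ∧ μ' i ≤ n + ε') ∧
          (∀ i j, ∫ x, f' i x * f' j x ∂(riemannianMeasure g) = if i = j then 1 else 0)) :
    aubry_diffeomorph_sphere_of_eigenvalue_pinching := by
  refine aubry_diffeomorph_sphere_of_eigenvalue_pinching_of_volume_pinching hCC ?_
  intro n hn δ hδ
  obtain ⟨ε₂, hε₂, H12⟩ := h12 n hn δ hδ
  obtain ⟨ε₃, hε₃, H19⟩ := h19 n hn ε₂ hε₂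
  refine ⟨ε₃, hε₃, ?_⟩
  intro M _ _ _ _ _ _ _ _ _ _ g hLC f μ hRic hf hΔ hμ horth
  obtain ⟨f', μ', hf', hΔ', hμ', horth'⟩ := H19 M g hLC f μ hRic hf hΔ hμ horth
  exact H12 M g hLC f' μ' hRic hf' hΔ' hμ' horth'

end Assembly

end Literature.Geometry.Riemannian

end
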